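import Mathlib

/-!
# Normality goes up along weakly étale ring maps

[cite: StacksProject, Tags 092C (`lemma-key`), 092S–092W; used in Tag 092Z (Olivier) and
hence in Bhatt–Scholze, *The pro-étale topology for schemes*, Theorem 2.3.4
(= arXiv:1309.1198v2), via de Jong's proof of Olivier's theorem]

We follow de Jong's argument (Stacks, §"Weakly étale ring maps"):

* `Module.Flat` of an algebra over a weakly étale extension descends from flatness over the
  base (`flat_of_weaklyEtale_of_flat`, the ring form of Stacks 092C);
* rings all of whose submodules of flat modules are flat (`SubmoduleFlat`, "weak dimension
  ≤ 1" in the form 092S (4)); products of valuation rings have this property (092T);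
* `isIntegrallyClosedIn_of_submoduleFlat` (092V): a weakly étale algebra over such a ring is
  integrally closed in any flat "ring of fractions";
* `exists_eq_one_tmul_of_isIntegral` (092W): for `R` a subring integrally closed in a field
  `K` and `B` weakly étale over `R`, every element of `K ⊗[R] B` integral over `B` lies in `B`.
-/

universe u

namespace Literature.RingTheory.Flat

open TensorProduct

noncomputable section

/-! ### Stacks 092C for algebras -/

/-- **Stacks 092C (ring form).** If `A → B` is weakly étale and `C` is a `B`-algebra which is
flat over `A`, then `C` is flat over `B`: `B → C` factors as `B → C ⊗[A] B → C ⊗[B] B = C`,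
the first map being a base change of `A → C` and the second a base change of the flat
multiplication `B ⊗[A] B → B`. [cite: StacksProject, Tag 092C] -/
theorem flat_of_weaklyEtale_of_flat (A B C : Type u) [CommRing A] [CommRing B] [CommRing C]
    [Algebra A B] [Algebra B C] [Algebra A C] [IsScalarTower A B C] [Algebra.WeaklyEtale A B]
    [Module.Flat A C] : Module.Flat B C := by
  -- the flat map `C ⊗[A] B → C ⊗[B] B`
  have h1 : (Algebra.TensorProduct.mapOfCompatibleSMul B A C C B).Flat :=
    RingHom.Flat.mapOfCompatibleSMul C B (Algebra.WeaklyEtale.flat_lmul' A B)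
  -- the flat map `B → C ⊗[A] B`
  have h2 : (Algebra.TensorProduct.includeRight (R := A) (A := C) (B := B)).Flat := by
    have e : (Algebra.TensorProduct.includeRight (R := A) (A := C) (B := B)) =
        ((Algebra.TensorProduct.comm A B C).toAlgHom).comp Algebra.TensorProduct.includeLeft := by
      ext b; simp
    rw [e]
    refine RingHom.Flat.comp ?_ (RingHom.Flat.of_bijective (Algebra.TensorProduct.comm A B C).bijective)
    change (algebraMap B (B ⊗[A] C)).Flat
    rw [RingHom.flat_algebraMap_iff]
    infer_instance
  -- the isomorphism `C ⊗[B] B ≅ C`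
  have h3 : (Algebra.TensorProduct.rid B C C).toAlgHom.Flat :=
    RingHom.Flat.of_bijective (Algebra.TensorProduct.rid B C C).bijective
  have h := h2.comp (h1.comp h3)
  have heq : ((Algebra.TensorProduct.rid B C C).toAlgHom.toRingHom.comp
      (Algebra.TensorProduct.mapOfCompatibleSMul B A C C B).toRingHom).comp
      (Algebra.TensorProduct.includeRight (R := A) (A := C) (B := B)).toRingHom =
      algebraMap B C := by
    ext b
    simp [Algebra.algebraMap_eq_smul_one]
  change RingHom.Flat (((Algebra.TensorProduct.rid B C C).toAlgHom.toRingHom.comp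
      (Algebra.TensorProduct.mapOfCompatibleSMul B A C C B).toRingHom).comp
      (Algebra.TensorProduct.includeRight (R := A) (A := C) (B := B)).toRingHom) at h
  rw [heq, RingHom.flat_algebraMap_iff] at h
  exact h

/-! ### Rings whose submodules of flat modules are flat (weak dimension ≤ 1) -/

/-- **Weak dimension ≤ 1** in the form of Stacks 092S (4): every submodule of a flat module
is flat. [cite: StacksProject, Tag 092S] -/
def SubmoduleFlat (A : Type u) [CommRing A] : Prop :=
  ∀ (M : Type u) [AddCommGroup M] [Module A M] [Module.Flat A M] (N : Submodule A M),
    Module.Flat A N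

/-- Stacks 092S (2) ⇒ (4): if every finitely generated ideal is flat then every submodule of
a flat module is flat.  (Test flatness of `N ⊆ M` against a finitely generated ideal `I`:
`I ⊗ N → I ⊗ M → A ⊗ M` is injective.) [cite: StacksProject, Tag 092S] -/
theorem submoduleFlat_of_ideal (A : Type u) [CommRing A]
    (h : ∀ I : Ideal A, I.FG → Module.Flat A I) : SubmoduleFlat A := by
  intro M _ _ _ N
  rw [Module.Flat.iff_lTensor_injective]
  intro I hI
  haveI := h I hI
  -- `N ⊗ I → M ⊗ I → M ⊗ A` is injective, and factors through `N ⊗ I → N ⊗ A`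
  have h1 : Function.Injective (N.subtype.rTensor I) :=
    Module.Flat.rTensor_preserves_injective_linearMap _ N.injective_subtype
  have h2 : Function.Injective (I.subtype.lTensor M) :=
    (Module.Flat.iff_lTensor_injective' (R := A) (M := M)).1 inferInstance I
  have h12 : Function.Injective (TensorProduct.map N.subtype I.subtype) := by
    rw [← LinearMap.lTensor_comp_rTensor]; exact h2.comp h1
  rw [← LinearMap.rTensor_comp_lTensor, LinearMap.coe_comp] at h12
  exact Function.Injective.of_comp h12


/-! ### Products of valuation rings (Stacks 092T) -/

section PiValuation

/-- In a valuation ring, a nonempty finite set has an element dividing all the others.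
[folklore] -/
theorem exists_mem_dvd_all {V : Type u} [CommRing V] [IsDomain V] [ValuationRing V]
    (F : Finset V) (hF : F.Nonempty) : ∃ g ∈ F, ∀ f ∈ F, g ∣ f := by
  classical
  induction F using Finset.induction_on with
  | empty => exact absurd hF Finset.not_nonempty_empty
  | insert a F ha ih =>
    rcases F.eq_empty_or_nonempty with h | h
    · subst h
      exact ⟨a, Finset.mem_insert_self _ _, fun f hf => by
        rw [Finset.insert_empty, Finset.mem_singleton] at hf; rw [hf]⟩
    · obtain ⟨g, hg, hdiv⟩ := ih h
      rcases ValuationRing.dvd_total a g with hag | hga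
      · refine ⟨a, Finset.mem_insert_self _ _, fun f hf => ?_⟩
        rcases Finset.mem_insert.1 hf with rfl | hf
        exacts [dvd_rfl, hag.trans (hdiv f hf)]
      · refine ⟨g, Finset.mem_insert_of_mem hg, fun f hf => ?_⟩
        rcases Finset.mem_insert.1 hf with rfl | hf
        exacts [hga, hdiv f hf]

variable {ι : Type u} (O : ι → Type u) [∀ i, CommRing (O i)] [∀ i, IsDomain (O i)]
  [∀ i, ValuationRing (O i)]

/-- In a product of valuation rings every finitely generated ideal is principal.
[cite: StacksProject, Tag 092T] -/
theorem exists_eq_span_singleton_pi (I : Ideal (Π i, O i)) (hI : I.FG) :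
    ∃ g : Π i, O i, I = Ideal.span {g} := by
  classical
  obtain ⟨F, rfl⟩ := hI
  rcases F.eq_empty_or_nonempty with hF | hF
  · exact ⟨0, by rw [hF, Finset.coe_empty, Ideal.span_empty, Ideal.span_singleton_zero]⟩
  · -- at each index choose a generator of minimal valuation
    have hchoice : ∀ i, ∃ f ∈ F, ∀ f' ∈ F, f i ∣ f' i := by
      intro i
      obtain ⟨x, hx, hdiv⟩ := exists_mem_dvd_all (F.image fun f => f i)
        (hF.image _)
      obtain ⟨f, hf, rfl⟩ := Finset.mem_image.1 hx
      exact ⟨f, hf, fun f' hf' => hdiv _ (Finset.mem_image_of_mem _ hf')⟩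
    choose c hc hcd using hchoice
    refine ⟨fun i => c i i, le_antisymm ?_ ?_⟩
    · rw [Ideal.span_le]
      intro f hf
      choose a ha using fun i => hcd i f hf
      refine Ideal.mem_span_singleton'.2 ⟨a, funext fun i => ?_⟩
      rw [Pi.mul_apply, mul_comm]; exact (ha i).symm
    · rw [Ideal.span_singleton_le_iff_mem]
      have : (fun i => c i i) = ∑ f ∈ F, (fun i => if c i = f then (1 : O i) else 0) * f := by
        funext i
        simp only [Finset.sum_apply, Pi.mul_apply, ite_mul, one_mul, zero_mul]
        rw [Finset.sum_ite_eq F (c i) (fun f => f i), if_pos (hc i)]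
      rw [this]
      exact Ideal.sum_mem _ fun f hf => Ideal.mul_mem_left _ _ (Ideal.subset_span hf)

omit [∀ i, ValuationRing (O i)] in
/-- In a product of domains, a principal ideal `(g)` is isomorphic to the direct summand
`(e)`, `e` the support idempotent of `g`; hence it is flat. [cite: StacksProject, Tag 092T] -/
theorem flat_span_singleton_pi (g : Π i, O i) :
    Module.Flat (Π i, O i) (Ideal.span ({g} : Set (Π i, O i))) := by
  classical
  let e : (Π i, O i) := fun i => if g i = 0 then 0 else 1
  have he2 : e * e = e := by
    funext i; by_cases h : g i = 0 <;> simp [e, h, Pi.mul_apply]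
  have heg : e * g = g := by
    funext i; by_cases h : g i = 0 <;> simp [e, h, Pi.mul_apply]
  have hker : ∀ x : (Π i, O i), x * g = 0 → x * e = 0 := by
    intro x hx; funext i
    have hi := congr_fun hx i
    simp only [Pi.mul_apply, Pi.zero_apply, mul_eq_zero] at hi
    by_cases h : g i = 0
    · simp [e, h, Pi.mul_apply]
    · simp [e, h, hi.resolve_right h, Pi.mul_apply]
  let J : Ideal (Π i, O i) := Ideal.span {e}
  have hJ : ∀ x ∈ J, x * e = x := by
    intro x hx
    obtain ⟨a, rfl⟩ := Ideal.mem_span_singleton'.1 hx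
    rw [mul_assoc, he2]
  -- `J` is a retract of `P`
  let retr : (Π i, O i) →ₗ[Π i, O i] J :=
    { toFun := fun x => ⟨x * e, Ideal.mem_span_singleton'.2 ⟨x, rfl⟩⟩
      map_add' := fun x y => by ext; simp [add_mul]
      map_smul' := fun a x => by ext; simp [mul_assoc] }
  haveI : Module.Flat (Π i, O i) J := Module.Flat.of_retract (Submodule.subtype J) retr
    (LinearMap.ext fun x => Subtype.ext (hJ x.1 x.2))
  -- `J ≅ (g)`
  let θ : J →ₗ[Π i, O i] Ideal.span ({g} : Set (Π i, O i)) :=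
    { toFun := fun x => ⟨x.1 * g, Ideal.mem_span_singleton'.2 ⟨x.1, rfl⟩⟩
      map_add' := fun x y => by ext; simp [add_mul]
      map_smul' := fun a x => by ext; simp [mul_assoc] }
  have hθ : Function.Bijective θ := by
    constructor
    · intro x y hxy
      have h1 : (x.1 - y.1) * g = 0 := by
        have := congrArg Subtype.val hxy
        simp only [θ, LinearMap.coe_mk, AddHom.coe_mk] at this
        rw [sub_mul, this, sub_self]
      have h2 := hker _ h1
      rw [sub_mul, sub_eq_zero, hJ x.1 x.2, hJ y.1 y.2] at h2
      exact Subtype.ext h2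
    · rintro ⟨y, hy⟩
      obtain ⟨a, rfl⟩ := Ideal.mem_span_singleton'.1 hy
      refine ⟨⟨a * e, Ideal.mem_span_singleton'.2 ⟨a, rfl⟩⟩, Subtype.ext ?_⟩
      change a * e * g = a * g
      rw [mul_assoc, heg]
  exact Module.Flat.of_linearEquiv (LinearEquiv.ofBijective θ hθ).symm

/-- **Stacks 092T/092S.** A product of valuation rings has weak dimension `≤ 1`: every
submodule of a flat module is flat. [cite: StacksProject, Tag 092T] -/
theorem submoduleFlat_pi_valuationRing : SubmoduleFlat (Π i, O i) :=
  submoduleFlat_of_ideal _ fun I hI => by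
    obtain ⟨g, rfl⟩ := exists_eq_span_singleton_pi O I hI
    exact flat_span_singleton_pi O g

end PiValuation


/-! ### Stacks 092V: weakly étale algebras over rings of weak dimension ≤ 1 -/

section IntegrallyClosed

variable {V : Type u} [CommRing V]
  {A₁ : Type u} [CommRing A₁] [Algebra V A₁]
  {W : Type u} [CommRing W] [Algebra A₁ W] [Algebra V W] [IsScalarTower V A₁ W]
  (T : Submonoid V)

/-- Common denominators: in `A₂ ⊗[A₁] W`, every element becomes an elementary tensor `y ⊗ 1`
after multiplication by `1 ⊗ t` for some `t ∈ T`, provided every element of `W` does.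
[cite: StacksProject, Tag 092V] -/
theorem exists_tmul_one_eq (A₂ : Subalgebra A₁ W)
    (hfrac : ∀ w : W, ∃ t ∈ T, ∃ a : A₁, algebraMap A₁ W a = algebraMap V W t * w)
    (ξ : A₂ ⊗[A₁] W) :
    ∃ t ∈ T, ∃ y : A₂, (1 : A₂) ⊗ₜ[A₁] (algebraMap V W t) * ξ = y ⊗ₜ[A₁] (1 : W) := by
  induction ξ using TensorProduct.induction_on with
  | zero => exact ⟨1, T.one_mem, 0, by simp⟩
  | tmul a w =>
    obtain ⟨t, ht, c, hc⟩ := hfrac w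
    refine ⟨t, ht, c • a, ?_⟩
    rw [Algebra.TensorProduct.tmul_mul_tmul, one_mul, ← hc, Algebra.algebraMap_eq_smul_one,
      TensorProduct.tmul_smul, TensorProduct.smul_tmul']
  | add ξ₁ ξ₂ h₁ h₂ =>
    obtain ⟨t₁, ht₁, y₁, hy₁⟩ := h₁
    obtain ⟨t₂, ht₂, y₂, hy₂⟩ := h₂
    refine ⟨t₁ * t₂, T.mul_mem ht₁ ht₂, algebraMap V A₁ t₂ • y₁ + algebraMap V A₁ t₁ • y₂, ?_⟩
    have e1 : (1 : A₂) ⊗ₜ[A₁] (algebraMap V W (t₁ * t₂)) =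
        (1 : A₂) ⊗ₜ[A₁] (algebraMap V W t₂) * (1 : A₂) ⊗ₜ[A₁] (algebraMap V W t₁) := by
      rw [Algebra.TensorProduct.tmul_mul_tmul, one_mul, ← map_mul, mul_comm]
    have e2 : (1 : A₂) ⊗ₜ[A₁] (algebraMap V W (t₁ * t₂)) =
        (1 : A₂) ⊗ₜ[A₁] (algebraMap V W t₁) * (1 : A₂) ⊗ₜ[A₁] (algebraMap V W t₂) := by
      rw [Algebra.TensorProduct.tmul_mul_tmul, one_mul, ← map_mul]
    rw [mul_add, TensorProduct.add_tmul]
    congr 1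
    · rw [e1, mul_assoc, hy₁, Algebra.TensorProduct.tmul_mul_tmul, one_mul, mul_one,
        IsScalarTower.algebraMap_apply V A₁ W, Algebra.algebraMap_eq_smul_one,
        TensorProduct.tmul_smul, TensorProduct.smul_tmul']
    · rw [e2, mul_assoc, hy₂, Algebra.TensorProduct.tmul_mul_tmul, one_mul, mul_one,
        IsScalarTower.algebraMap_apply V A₁ W, Algebra.algebraMap_eq_smul_one,
        TensorProduct.tmul_smul, TensorProduct.smul_tmul']

/-- The multiplication map `A₂ ⊗[A₁] W → W` is injective when `W` is a ring of
`T`-fractions of `A₁` on which `T` acts invertibly. [cite: StacksProject, Tag 092V] -/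
theorem productMap_injective (A₂ : Subalgebra A₁ W)
    (hTW : ∀ t ∈ T, IsUnit (algebraMap V W t))
    (hfrac : ∀ w : W, ∃ t ∈ T, ∃ a : A₁, algebraMap A₁ W a = algebraMap V W t * w) :
    Function.Injective (Algebra.TensorProduct.productMap A₂.val (AlgHom.id A₁ W)) := by
  set m := Algebra.TensorProduct.productMap A₂.val (AlgHom.id A₁ W)
  rw [injective_iff_map_eq_zero]
  intro ξ hξ
  obtain ⟨t, ht, y, hy⟩ := exists_tmul_one_eq T A₂ hfrac ξ
  have hy0 : (y : W) = 0 := by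
    have := congrArg m hy
    rw [map_mul, hξ, mul_zero] at this
    simpa [m] using this.symm
  have hy0' : y = 0 := Subtype.ext hy0
  rw [hy0', TensorProduct.zero_tmul] at hy
  have hu : IsUnit ((1 : A₂) ⊗ₜ[A₁] (algebraMap V W t)) :=
    (hTW t ht).map (Algebra.TensorProduct.includeRight : W →ₐ[A₁] A₂ ⊗[A₁] W)
  exact (hu.mul_right_eq_zero).1 hy

variable (hV : SubmoduleFlat V) [Algebra.WeaklyEtale V A₁] [Module.Flat V W]

include hV in
/-- **Stacks 092V.** Let `V` have weak dimension `≤ 1`, `V → A₁` weakly étale, and `A₁ → W`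
an injective map into a flat `V`-algebra of `T`-fractions of `A₁` (`T ⊆ V` acting invertibly
on `W`).  Then `A₁` is integrally closed in `W`: for `x` integral, `A₂ = A₁[x]` is finite over
`A₁`, flat over `V` (a submodule of `W`), hence flat over `A₁` (092C), and
`A₂ ⊗[A₁] A₂ → W` is injective, so `A₁ → A₂` is a finite epimorphism, i.e. surjective.
[cite: StacksProject, Tag 092V] -/
theorem isIntegrallyClosedIn_of_submoduleFlat
    (hTW : ∀ t ∈ T, IsUnit (algebraMap V W t))
    (hfrac : ∀ w : W, ∃ t ∈ T, ∃ a : A₁, algebraMap A₁ W a = algebraMap V W t * w)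
    (hinj : Function.Injective (algebraMap A₁ W)) : IsIntegrallyClosedIn A₁ W := by
  refine (isIntegrallyClosedIn_iff).2 ⟨hinj, fun {x} hx => ?_⟩
  let A₂ : Subalgebra A₁ W := Algebra.adjoin A₁ {x}
  haveI : Module.Finite A₁ A₂ := Algebra.finite_adjoin_simple_of_isIntegral hx
  -- `A₂` is flat over `V`, as a submodule of `W`
  haveI : Module.Flat V A₂ := by
    haveI := hV W ((Subalgebra.toSubmodule A₂).restrictScalars V)
    exact Module.Flat.of_linearEquiv (R := V) (M := (Subalgebra.toSubmodule A₂).restrictScalars V)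
      (N := A₂) (LinearEquiv.refl V _)
  -- hence flat over `A₁`
  haveI : Module.Flat A₁ A₂ := flat_of_weaklyEtale_of_flat V A₁ A₂
  -- `A₁ → A₂` is an epimorphism
  haveI : Algebra.IsEpi A₁ A₂ := by
    refine ⟨?_⟩
    have h1 : Function.Injective ((A₂.val.toLinearMap).lTensor A₂) :=
      Module.Flat.lTensor_preserves_injective_linearMap _ Subtype.val_injective
    have h2 := productMap_injective T A₂ hTW hfrac
    have hsq : ∀ ξ : A₂ ⊗[A₁] A₂,
        (A₂.val) (TensorProduct.lift (LinearMap.mul A₁ A₂) ξ) =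
          Algebra.TensorProduct.productMap A₂.val (AlgHom.id A₁ W)
            ((A₂.val.toLinearMap).lTensor A₂ ξ) := by
      intro ξ
      induction ξ using TensorProduct.induction_on with
      | zero => simp
      | tmul a b => simp
      | add ξ₁ ξ₂ h₁ h₂ => simp only [map_add, h₁, h₂]
    intro ξ₁ ξ₂ h
    have := congrArg A₂.val h
    rw [hsq, hsq] at this
    exact h1 (h2 this)
  have hsurj : Function.Surjective (algebraMap A₁ A₂) :=
    (Algebra.isEpi_iff_surjective_algebraMap_of_finite (R := A₁) (A := A₂)).1 inferInstance
  obtain ⟨a, ha⟩ := hsurj ⟨x, Algebra.self_mem_adjoin_singleton A₁ x⟩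
  exact ⟨a, by rw [IsScalarTower.algebraMap_apply A₁ A₂ W, ha]; rfl⟩

end IntegrallyClosed


/-! ### Stacks 092U/092W: normality goes up -/

section NormalityGoesUp

variable {K : Type u} [Field K] (R : Subring K)

/-- Valuation subrings of `K` containing `R`. [cite: StacksProject, Tag 092U] -/
abbrev ValOver : Type u := {V : ValuationSubring K // R ≤ V.toSubring}

/-- The product `∏ V` of all valuation rings of `K` containing `R`. [cite: StacksProject, Tag 092U] -/
abbrev VProd : Type u := Π s : ValOver R, s.1

/-- The product `∏ K` indexed by the valuation rings containing `R`.
[cite: StacksProject, Tag 092U] -/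
abbrev KProd : Type u := ValOver R → K

/-- `V ⊇ R` is an `R`-algebra. [folklore] -/
instance algebraValOver (s : ValOver R) : Algebra R s.1 := (Subring.inclusion s.2).toAlgebra

/-- The componentwise inclusion `∏ V → ∏ K`. [cite: StacksProject, Tag 092T] -/
def iotaV : VProd R →ₐ[R] KProd R where
  toFun v s := (v s : K)
  map_one' := rfl
  map_mul' _ _ := rfl
  map_zero' := rfl
  map_add' _ _ := rfl
  commutes' _ := rfl

/-- The diagonal `K → ∏ K`. [cite: StacksProject, Tag 092U] -/
def diagK : K →ₐ[R] KProd R where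
  toFun k _ := k
  map_one' := rfl
  map_mul' _ _ := rfl
  map_zero' := rfl
  map_add' _ _ := rfl
  commutes' _ := rfl

/-- `algebraMap (∏ V) (∏ K)` (Mathlib's componentwise algebra structure) is the componentwise
inclusion. [folklore] -/
theorem algebraMap_vProd_apply (v : VProd R) (s : ValOver R) :
    algebraMap (VProd R) (KProd R) v s = (v s : K) := rfl

/-- `iotaV` is the algebra map. [folklore] -/
theorem iotaV_apply (v : VProd R) : iotaV R v = algebraMap (VProd R) (KProd R) v := rfl

/-- Compatibility of the `R`- and `∏ V`-structures on `∏ K`. [folklore] -/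
instance isScalarTower_vProd : IsScalarTower R (VProd R) (KProd R) :=
  IsScalarTower.of_algebraMap_eq fun _ => rfl

/-- Commutation of the `R`- and `∏ V`-actions on `∏ K`. [folklore] -/
instance smulCommClass_vProd : SMulCommClass R (VProd R) (KProd R) :=
  ⟨fun r v k => funext fun s => by
    change algebraMap R K r * ((v s : K) * k s) = (v s : K) * (algebraMap R K r * k s)
    ring⟩

/-- The multiplicative set of componentwise non-zero elements of `∏ V`.
[cite: StacksProject, Tag 092T] -/
def nonZero : Submonoid (VProd R) where
  carrier := {t | ∀ s, (t s : K) ≠ 0}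
  one_mem' := fun s => by simp
  mul_mem' := fun {a b} ha hb s => by
    rw [Pi.mul_apply]
    exact mul_ne_zero (ha s) (hb s)

/-- `∏ K` is the localization of `∏ V` at the componentwise non-zero elements.
[cite: StacksProject, Tag 092T] -/
instance isLocalization_kProd : IsLocalization (nonZero R) (KProd R) where
  map_units t := by
    rw [Pi.isUnit_iff]
    intro s
    exact isUnit_iff_ne_zero.2 (t.2 s)
  surj k := by
    classical
    have hcomp : ∀ s : ValOver R, ∃ (v : s.1) (t : s.1), (t : K) ≠ 0 ∧ k s * t = v := by
      intro s
      rcases s.1.mem_or_inv_mem (k s) with h | h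
      · exact ⟨⟨k s, h⟩, 1, by simp, by simp⟩
      · by_cases hk : k s = 0
        · exact ⟨0, 1, by simp, by simp [hk]⟩
        · exact ⟨1, ⟨(k s)⁻¹, h⟩, by simp [hk], by simp [hk]⟩
    choose v t ht hvt using hcomp
    exact ⟨(v, ⟨t, ht⟩), funext fun s => hvt s⟩
  exists_of_eq {v w} h := ⟨1, by
    have : v = w := funext fun s => Subtype.ext (congr_fun h s)
    rw [this]⟩

/-- `∏ K` is flat over `∏ V`. [cite: StacksProject, Tag 092T] -/
instance flat_kProd : Module.Flat (VProd R) (KProd R) := IsLocalization.flat _ (nonZero R)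

variable [IsIntegrallyClosedIn R K]

/-- **Stacks 092U.** `R = (∏ V) ×_{∏ K} K`: the sequence `0 → R → (∏ V) × K → ∏ K` is exact,
because `R` is the intersection of the valuation rings containing it (Stacks 090P).
[cite: StacksProject, Tag 092U] -/
theorem exact_vProd :
    Function.Exact ((Algebra.linearMap R (VProd R)).prod (Algebra.linearMap R K))
      ((iotaV R).toLinearMap ∘ₗ LinearMap.fst R (VProd R) K -
        (diagK R).toLinearMap ∘ₗ LinearMap.snd R (VProd R) K) := by
  intro y
  constructor
  · intro hy
    obtain ⟨v, k⟩ := y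
    have hvk : ∀ s, (v s : K) = k := fun s => by
      have := congr_fun hy s
      simpa [iotaV, diagK, sub_eq_zero] using this
    have hk : k ∈ R := by
      by_contra hk
      obtain ⟨V', hRV', hkV'⟩ := Subring.exists_le_valuationSubring_of_isIntegrallyClosedIn hk
      exact hkV' (hvk ⟨V', hRV'⟩ ▸ (v ⟨V', hRV'⟩).2)
    refine ⟨⟨k, hk⟩, Prod.ext (funext fun s => Subtype.ext ?_) rfl⟩
    exact (hvk s).symm
  · rintro ⟨r, rfl⟩
    funext s
    exact sub_eq_zero.2 rfl

omit [IsIntegrallyClosedIn R K]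

variable (B : Type u) [CommRing B] [Algebra R B]

/-- `rTensor` of the first projection computed through `prodLeft`. [folklore] -/
theorem rTensor_fst_eq (u : (VProd R × K) ⊗[R] B) :
    (LinearMap.fst R (VProd R) K).rTensor B u = (TensorProduct.prodLeft R R _ _ B u).1 := by
  induction u using TensorProduct.induction_on with
  | zero => simp
  | tmul x b => rfl
  | add x y hx hy => simp [hx, hy]

/-- `rTensor` of the second projection computed through `prodLeft`. [folklore] -/
theorem rTensor_snd_eq (u : (VProd R × K) ⊗[R] B) :
    (LinearMap.snd R (VProd R) K).rTensor B u = (TensorProduct.prodLeft R R _ _ B u).2 := by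
  induction u using TensorProduct.induction_on with
  | zero => simp
  | tmul x b => rfl
  | add x y hx hy => simp [hx, hy]

variable [Algebra.WeaklyEtale R B] [IsIntegrallyClosedIn R K]

/-- **Stacks 092U ⊗ B.** By flatness of `B`, `B = (∏ V ⊗ B) ×_{∏ K ⊗ B} (K ⊗ B)`: an element
of `K ⊗[R] B` whose image in `∏ K ⊗[R] B` comes from `∏ V ⊗[R] B` comes from `B`.
[cite: StacksProject, Tag 092W] -/
theorem exists_eq_one_tmul_of_eq (y : VProd R ⊗[R] B) (z : K ⊗[R] B)
    (h : Algebra.TensorProduct.map (iotaV R) (AlgHom.id R B) y =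
      Algebra.TensorProduct.map (diagK R) (AlgHom.id R B) z) :
    ∃ b : B, (1 : K) ⊗ₜ[R] b = z := by
  set δ := (Algebra.linearMap R (VProd R)).prod (Algebra.linearMap R K)
  set f := (iotaV R).toLinearMap ∘ₗ LinearMap.fst R (VProd R) K -
        (diagK R).toLinearMap ∘ₗ LinearMap.snd R (VProd R) K
  have hex : Function.Exact (δ.rTensor B) (f.rTensor B) :=
    Module.Flat.rTensor_exact B (exact_vProd R)
  let u : (VProd R × K) ⊗[R] B := (TensorProduct.prodLeft R R _ _ B).symm (y, z)
  have hu1 : (LinearMap.fst R (VProd R) K).rTensor B u = y := by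
    rw [rTensor_fst_eq, LinearEquiv.apply_symm_apply]
  have hu2 : (LinearMap.snd R (VProd R) K).rTensor B u = z := by
    rw [rTensor_snd_eq, LinearEquiv.apply_symm_apply]
  have hfu : f.rTensor B u = 0 := by
    simp only [f, LinearMap.rTensor_sub, LinearMap.rTensor_comp, LinearMap.sub_apply,
      LinearMap.comp_apply, hu1, hu2, sub_eq_zero]
    exact h
  obtain ⟨w, hw⟩ := (hex u).1 hfu
  refine ⟨TensorProduct.lid R B w, ?_⟩
  have hw' : w = (1 : R) ⊗ₜ[R] (TensorProduct.lid R B w) := by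
    rw [← TensorProduct.lid_symm_apply, LinearEquiv.symm_apply_apply]
  rw [← hu2, ← hw, hw']
  simp [δ]

/-- **Normality goes up (Stacks 092W).** Let `R` be a subring integrally closed in a field
`K` and `B` a weakly étale `R`-algebra. Then `B` is integrally closed in `K ⊗[R] B`: every
element of `K ⊗[R] B` satisfying a monic polynomial with coefficients in `B` is of the form
`1 ⊗ b`. (de Jong: `∏ V ⊗ B` is integrally closed in `∏ K ⊗ B` by 092T, 092C and 092V, and
`B = (∏ V ⊗ B) ×_{∏ K ⊗ B} (K ⊗ B)` by 092U and flatness.)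
[cite: StacksProject, Tag 092W] -/
theorem exists_eq_one_tmul_of_isIntegral (z : K ⊗[R] B) (p : Polynomial B) (hp : p.Monic)
    (hz : p.eval₂ (Algebra.TensorProduct.includeRight (R := R) (A := K) (B := B)).toRingHom
      z = 0) : ∃ b : B, (1 : K) ⊗ₜ[R] b = z := by
  -- the players
  let A₁ := VProd R ⊗[R] B
  let W := KProd R ⊗[R] B
  let φ : A₁ →ₐ[R] W := Algebra.TensorProduct.map (iotaV R) (AlgHom.id R B)
  letI : Algebra A₁ W := φ.toRingHom.toAlgebra
  haveI : IsScalarTower (VProd R) A₁ W := IsScalarTower.of_algebraMap_eq fun v => by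
    change algebraMap (VProd R) W v = φ (algebraMap (VProd R) A₁ v)
    rw [Algebra.TensorProduct.algebraMap_apply, Algebra.TensorProduct.algebraMap_apply,
      Algebra.TensorProduct.map_tmul, map_one, Algebra.algebraMap_self, RingHom.id_apply]
    rfl
  -- `W` is flat over `∏ V`
  haveI : Module.Flat (VProd R) W :=
    Module.Flat.of_linearEquiv
      (TensorProduct.AlgebraTensorModule.cancelBaseChange R (VProd R) (VProd R) (KProd R) B).symm
  -- `∏ V ⊗ B` is integrally closed in `∏ K ⊗ B`
  have hTW : ∀ t ∈ nonZero R, IsUnit (algebraMap (VProd R) W t) := fun t ht =>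
    (IsLocalization.map_units (KProd R) (⟨t, ht⟩ : nonZero R)).map (algebraMap (KProd R) W)
  have hfrac : ∀ w : W, ∃ t ∈ nonZero R, ∃ a : A₁,
      algebraMap A₁ W a = algebraMap (VProd R) W t * w := by
    intro w
    induction w using TensorProduct.induction_on with
    | zero => exact ⟨1, (nonZero R).one_mem, 0, by simp⟩
    | tmul k b =>
      obtain ⟨⟨v, t⟩, hvt⟩ := IsLocalization.surj (nonZero R) k
      refine ⟨t.1, t.2, v ⊗ₜ b, ?_⟩
      change φ (v ⊗ₜ b) = _
      rw [Algebra.TensorProduct.map_tmul, AlgHom.id_apply, Algebra.TensorProduct.algebraMap_apply,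
        Algebra.TensorProduct.tmul_mul_tmul, one_mul, mul_comm, hvt]
      rfl
    | add w₁ w₂ h₁ h₂ =>
      obtain ⟨t₁, ht₁, a₁, ha₁⟩ := h₁
      obtain ⟨t₂, ht₂, a₂, ha₂⟩ := h₂
      refine ⟨t₁ * t₂, (nonZero R).mul_mem ht₁ ht₂,
        algebraMap (VProd R) A₁ t₂ * a₁ + algebraMap (VProd R) A₁ t₁ * a₂, ?_⟩
      rw [map_add, map_mul, map_mul, ← IsScalarTower.algebraMap_apply,
        ← IsScalarTower.algebraMap_apply, ha₁, ha₂, map_mul, mul_add]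
      ring
  have hinj : Function.Injective (algebraMap A₁ W) := by
    change Function.Injective φ
    have : (φ : A₁ → W) = (iotaV R).toLinearMap.rTensor B := by
      ext x; rfl
    rw [this]
    refine Module.Flat.rTensor_preserves_injective_linearMap _ fun v w hvw => ?_
    exact funext fun s => Subtype.ext (congr_fun hvw s)
  have hIC : IsIntegrallyClosedIn A₁ W :=
    isIntegrallyClosedIn_of_submoduleFlat (nonZero R) (submoduleFlat_pi_valuationRing _)
      hTW hfrac hinj
  -- the image of `z` in `W` is integral over `A₁`, hence comes from `A₁`
  let ψ : K ⊗[R] B →ₐ[R] W := Algebra.TensorProduct.map (diagK R) (AlgHom.id R B)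
  have hint : IsIntegral A₁ (ψ z) := by
    refine ⟨p.map (Algebra.TensorProduct.includeRight (R := R) (A := VProd R) (B := B)).toRingHom,
      hp.map _, ?_⟩
    rw [Polynomial.eval₂_map]
    have hcomp : (algebraMap A₁ W).comp
        (Algebra.TensorProduct.includeRight (R := R) (A := VProd R) (B := B)).toRingHom =
        ψ.toRingHom.comp (Algebra.TensorProduct.includeRight (R := R) (A := K) (B := B)).toRingHom := by
      ext b
      change φ ((1 : VProd R) ⊗ₜ[R] b) = ψ ((1 : K) ⊗ₜ[R] b)
      rw [Algebra.TensorProduct.map_tmul, Algebra.TensorProduct.map_tmul, map_one, map_one]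
    rw [hcomp, show ψ z = ψ.toRingHom z from rfl, ← Polynomial.hom_eval₂, hz, map_zero]
  obtain ⟨y, hy⟩ := ((isIntegrallyClosedIn_iff).1 hIC).2 hint
  exact exists_eq_one_tmul_of_eq R B y z hy

omit [IsIntegrallyClosedIn R K] in
/-- Injectivity half of "`B` is integrally closed in `K ⊗[R] B`": `b ↦ 1 ⊗ b` is injective
(flatness of `B`). [cite: StacksProject, Tag 092W] -/
theorem one_tmul_injective : Function.Injective fun b : B => (1 : K) ⊗ₜ[R] b := by
  intro b b' h
  have hinj : Function.Injective ((Algebra.linearMap R K).rTensor B) :=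
    Module.Flat.rTensor_preserves_injective_linearMap _ fun r r' hrr' => Subtype.ext hrr'
  have : (Algebra.linearMap R K).rTensor B ((1 : R) ⊗ₜ b) =
      (Algebra.linearMap R K).rTensor B ((1 : R) ⊗ₜ b') := by simpa using h
  have := hinj this
  simpa using congrArg (TensorProduct.lid R B) this

end NormalityGoesUp

end

end Literature.RingTheory.Flat
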